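import Summits.AtomisticToContinuum.HydrodynamicLimit.Theses.RelayRaceLocality
import Summits.AtomisticToContinuum.HydrodynamicLimit.Theorems.RestartPrinciple.Negative.ConsequentImpAntecedent

/-!
# `ConeLocalisation` (stmt-AtomisticToContinuum-12504): a refutation would refute the summit conjunct

Negative helper file of the standing crux disprover (`Cruxes/ConeLocalisation/Disproof.lean` §1;
refuter-cdisprove-stmt-AtomisticToContinuum-12504-0, 2026-08-17). No Theses declaration is asserted.

The crux is literally `LightConeInLaw → NearConstantShortTimeHL → S`, `S` = the short-time guarded
hydrodynamic limit from local-Gibbs time-0 data (verbatim the antecedent of the sibling crux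
`RestartPrinciple`, stmt-12503). Two kernel-checked facts record why the disprover reports "no kill":

* `not_hydrodynamicLimit_of_not_coneLocalisation` — the packing-guarded summit conjunct `G` implies `S`
  (`RestartPrincipleNegative.guardedConjunct_imp_shortTimeGuardedHL`: restrict the classical solution
  past `t`, keeping the strict packing guard by compactness), hence implies the crux; so ANY refutation of
  the crux is a refutation of `_root_.HydrodynamicLimit` itself;
* `not_coneLocalisation_iff` — exactly: `¬ ConeLocalisation` holds iff BOTH open antecedents (the light
  cone in law, XL; the near-constant short-time limit, open-problem grade) hold AND `S` fails.

Consequently the crux can only "die" through its parts, and a refuted antecedent makes it VACUOUSLY TRUE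
(a prover's ex-falso landing plus a planner's restatement), never false. What the ideators found instead is
a PROVABILITY gap (no density floor in `S`; see `TroughFamily.lean` and the Disproof file §3).
-/

namespace Summit.AtomisticToContinuum.HydrodynamicLimit.Theorems.ConeLocalisationNegative

open Literature.MathematicalPhysics.KineticTheory Literature.Analysis.FluidPDE
open Literature.Analysis.FunctionSpaces MeasureTheory Filter Set
open Summit.AtomisticToContinuum.HydrodynamicLimit.Theses.RelayRaceLocality
open Summit.AtomisticToContinuum.HydrodynamicLimit.Theorems.RestartPrincipleNegative

/-- **Any refutation of the crux `ConeLocalisation` refutes the summit conjunct**: `G → S` (tree lemma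
`guardedConjunct_imp_shortTimeGuardedHL`) and `S` is the consequent of the crux. [folklore] -/
theorem not_hydrodynamicLimit_of_not_coneLocalisation (h : ¬ ConeLocalisation) :
    ¬ _root_.HydrodynamicLimit := by
  intro hG
  apply h
  intro _ _
  exact guardedConjunct_imp_shortTimeGuardedHL hG

/-- **The refutation problem for `ConeLocalisation`, exactly**: its negation is equivalent to the
conjunction of its two open antecedents with the NEGATION of the short-time guarded hydrodynamic limit
`S` (spelled out verbatim; `S` is itself implied by the summit conjunct). [folklore] -/
theorem not_coneLocalisation_iff :
    ¬ ConeLocalisation ↔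
      (LightConeInLaw ∧ NearConstantShortTimeHL ∧
        ¬ (∃ η₀ : ℝ, 0 < η₀ ∧ ∀ M : ℝ, 0 < M → ∃ τ₁ : ℝ, 0 < τ₁ ∧ ∀ (a₀ θ₀ : T3 → ℝ) (u₀ : T3 → V3), Continuous a₀ → Continuous θ₀ → Continuous u₀ → (∀ x, 0 < a₀ x) → (∀ x, 0 < θ₀ x) → ∃ σ₀ : ℝ, 0 < σ₀ ∧ ∀ σ : ℝ, 0 < σ → σ < σ₀ → ∀ (T : ℝ) (ρ θ : ℝ → T3 → ℝ) (u : ℝ → T3 → V3), IsHardSphereEulerSolution σ T ρ u θ → ∀ Φ : (N : ℕ) → HardSphereFlow (Torus.geometry (Fin 3)) (hsDiameter σ N) (N + 1), TendstoHydroFieldsAt (fun N => localGibbsLaw σ a₀ u₀ θ₀ N (Φ N)) Φ ρ u θ 0 → ∀ t ∈ Set.Ico 0 (min T τ₁), (∀ s ∈ Set.Icc 0 t, ∀ x, ρ s x * σ ^ 3 < η₀ ∧ ρ s x ≤ M ∧ θ s x ≤ M ∧ M⁻¹ ≤ θ s x ∧ ‖u s x‖ ≤ M ∧ ∀ i j k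 : Fin 3, |Torus.partialDeriv i (ρ s) x| ≤ M ∧ ‖Torus.partialDeriv i (u s) x‖ ≤ M ∧ |Torus.partialDeriv i (θ s) x| ≤ M ∧ |Torus.partialDeriv i (Torus.partialDeriv j (ρ s)) x| ≤ M ∧ ‖Torus.partialDeriv i (Torus.partialDeriv j (u s)) x‖ ≤ M ∧ |Torus.partialDeriv i (Torus.partialDeriv j (θ s)) x| ≤ M ∧ |Torus.partialDeriv i (Torus.partialDeriv j (Torus.partialDeriv k (ρ s))) x| ≤ M ∧ ‖Torus.partialDeriv i (Torus.partialDeriv j (Torus.partialDeriv k (u s))) x‖ ≤ M ∧ |Torus.partialDeriv i (Torus.partialDeriv j (Torus.partialDeriv k (θ s))) x| ≤ M) → TendstoHydroFieldsAt (fun N => localGibbsLaw σ a₀ u₀ θ₀ N (Φ N)) Φ ρ u θ t)) := by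
  unfold ConeLocalisation
  constructor
  · intro h
    by_contra hc
    exact h fun hA hB => by_contra fun hS => hc ⟨hA, hB, hS⟩
  · rintro ⟨hA, hB, hS⟩ h
    exact hS (h hA hB)

end Summit.AtomisticToContinuum.HydrodynamicLimit.Theorems.ConeLocalisationNegative
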